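import Summits.HodgeConjecture.CorCM.SimpleCMProductsDimLeThreeBlocks
import Literature.NumberTheory.ComplexMultiplication.EmbeddingActionFaithful
import Literature.FieldTheory.Galois.NormalClosureDegree
import HarnessLib

/-!
# MULTI-FIELD WEIL ENGINE — THE SEXTIC CLOSURE-DEGREE TRICHOTOMY: a sextic CM field whose Galois closure has degree `6` or `12` HAS an imaginary quadratic subfield
# (converse of seat b16's `finrank_normalClosure_of_quadratic`); hence «imaginary quadratic subfield ⟺ `[L:ℚ] ∈ {6,12}` ⟺ `[L:ℚ] ∉ {24,48}`»

Cell `pub-hodgecm2` (COR-CM), seat b30 gen 37 (2026-08-25); count-neutral own lane MULTI-FIELD WEIL ENGINE (stem `MultiFieldWeil*`).  Theorems only; no definition, no named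
fact, no `sorry`.  `HC_CM` is NOT touched.  PURPOSE: the hypotheses «the sextic CM field `K` HAS ∕ has NO totally complex quadratic subfield» of the classes-per-field theorems
(`CorCM/MultiFieldWeilClassesPerField*`, `…TwoPerIsolatedField*`) and seat b16's ∕ p2's dichotomy «Galois closure of degree `6`/`12` versus `24`/`48` (pair flips)» are ONE
dichotomy.  Seat b16 proved «imaginary quadratic subfield ⟹ `[L:ℚ] ∈ {6, 12}`» (`finrank_normalClosure_of_quadratic`, via pair flips); this file proves the CONVERSE.

THE ARGUMENT (**`exists_totallyComplex_quadratic_of_finrank_le_twelve`**).  `G = Gal(L/ℚ)` acts faithfully on the six embeddings `X = Hom_ℚ(K, L)` (tree: `EmbeddingActionFaithful`);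
let `χ = sgn ∘ (G → Sym X)`.  Complex conjugation `c ∈ G` is a fixed-point-free involution of `X` (`conjGal_smul_ne`), i.e. three transpositions: `χ(c) = −1`.  So `Q = ker χ` has
index `2` and `k = L^Q` is a quadratic subfield of `L` moved by `c`, i.e. imaginary.  It lies in `x₀(K) = L^H`, `H = Stab(x₀)`, because `χ(H) = 1`: `|H| = [L:ℚ]/6 ∈ {1, 2}`, and
an involution `h ∈ H` fixes exactly the points `C_G(h)·x₀` of `X`, whose number `[C_G(h) : H]` divides `[G : H] = 6` and has the parity of `6` — hence equals `2`, so `h` is a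
product of two transpositions.  (§1 the sign of an involution; §2 `χ(c) = −1`; §3 `χ(H) = 1`; §4 the subfield; §5 the closure in `ℂ` and the equivalences.)

[cite: Dodson1984, §1.1 Imprimitivity Theorem; §5.1.2 Theorem] [cite: Lang2002, I §5 Prop. 5.1 and VI §1 Thm. 1.1, Cor. 1.4] [cite: Shimura1998, §8.4]

## References
* [Dodson1984] B. Dodson, *The structure of Galois groups of CM-fields*, Trans. AMS 283 (1984): §1.1 (the Galois group of the closure as an imprimitive permutation group of the
  embeddings, `ρ` central), §5.1.2 (sextic CM fields: `G` of order `6`, `12` — with an imaginary quadratic subfield — or `24`, `48`).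
* [Lang2002] S. Lang, *Algebra*, GTM 211: I §5 (orbits, `|G·x| = [G : G_x]`, sign of a permutation), VI §1 (Galois correspondence).
* [Shimura1998] G. Shimura, *Abelian Varieties with Complex Multiplication and Modular Functions*, §8.4.
-/

noncomputable section

open NumberField Module IntermediateField

namespace Summit.HodgeConjecture.CorCM.MultiFieldWeil

open Literature.NumberTheory.ComplexMultiplication NumberField.InfinitePlace

open scoped Classical

/-! ## §1 The sign of an involution -/

section Perm

variable {α : Type*} [Fintype α] [DecidableEq α]

/-- **The sign of an involution** `σ` (order `2`) is `(−1)^{#supp(σ)/2}`: its cycle type is `#supp/2` transpositions. [cite: Lang2002, I §5 Prop. 5.1] -/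
theorem sign_eq_of_orderOf_eq_two {σ : Equiv.Perm α} (h : orderOf σ = 2) : Equiv.Perm.sign σ = (-1 : ℤˣ) ^ (σ.support.card / 2) := by
  obtain ⟨n, hn⟩ := Equiv.Perm.cycleType_prime_order (σ := σ) (by rw [h]; exact Nat.prime_two)
  rw [h] at hn
  have hsum : σ.support.card = 2 * (n + 1) := by
    rw [← Equiv.Perm.sum_cycleType, hn, Multiset.sum_replicate, smul_eq_mul, mul_comm]
  rw [Equiv.Perm.sign_of_cycleType, hn, Multiset.sum_replicate, Multiset.card_replicate, smul_eq_mul, hsum,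
    Nat.mul_div_cancel_left _ Nat.two_pos, pow_add, pow_mul, Int.units_sq, one_mul]
  try rfl

end Perm

/-! ## §2 Complex conjugation has sign `−1` on the six embeddings -/

section Galois

variable {L : Type} [Field L] [NumberField L] [IsCMField L] {K : Type} [Field K] [NumberField K] [IsCMField K]

/-- **`χ(c) = −1`**: on the `2(2j+1)` embeddings of a CM field `K` of degree `2(2j+1)` into a CM normal closure `L`, complex conjugation `c` is a fixed-point-free involution,
a product of `2j+1` transpositions. [cite: Dodson1984, §1.1 Imprimitivity Theorem] [cite: Lang2002, I §5 Prop. 5.1] -/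
theorem sign_toPermHom_conjGal [IsNormalClosure ℚ K L] {j : ℕ} (hK : finrank ℚ K = 2 * (2 * j + 1)) :
    Equiv.Perm.sign (MulAction.toPermHom (L ≃ₐ[ℚ] L) (K →ₐ[ℚ] L) conjGal) = -1 := by
  classical
  set σ : Equiv.Perm (K →ₐ[ℚ] L) := MulAction.toPermHom (L ≃ₐ[ℚ] L) (K →ₐ[ℚ] L) conjGal with hσ
  have hσx : ∀ x, σ x = (conjGal : L ≃ₐ[ℚ] L) • x := fun x => rfl
  have hcard : Fintype.card (K →ₐ[ℚ] L) = 2 * (2 * j + 1) := (card_algHom_eq_finrank (L := L) K).trans hK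
  obtain ⟨x₀⟩ : Nonempty (K →ₐ[ℚ] L) := Fintype.card_pos_iff.1 (by rw [hcard]; omega)
  have hσ1 : σ ≠ 1 := fun h1 => conjGal_smul_ne (L := L) x₀ (by rw [← hσx, h1, Equiv.Perm.one_apply])
  have hσ2 : σ ^ 2 = 1 := by rw [hσ, ← map_pow, pow_two, conjGal_mul_conjGal, map_one]
  haveI : Fact (Nat.Prime 2) := ⟨Nat.prime_two⟩
  have hord : orderOf σ = 2 := orderOf_eq_prime hσ2 hσ1
  have hsupp : σ.support = Finset.univ := Finset.eq_univ_of_forall fun x => Equiv.Perm.mem_support.2 (by rw [hσx]; exact conjGal_smul_ne (L := L) x)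
  rw [sign_eq_of_orderOf_eq_two hord, hsupp, Finset.card_univ, hcard, Nat.mul_div_cancel_left _ Nat.two_pos]
  exact Odd.neg_one_pow ⟨j, rfl⟩

/-! ## §3 The stabiliser of an embedding has sign `+1` (sextic field, closure of degree `12`) -/

omit [IsCMField L] [IsCMField K] in
/-- **`χ(H) = 1`** for `H = Stab(x₀) = Gal(L/x₀K)` when `[K:ℚ] = 6`, `[L:ℚ] = 12`: the involution `h ∈ H` fixes exactly the points `C_G(h)·x₀`, in number `[C_G(h):H]`, a divisor of
`[G:H] = 6` with the parity of `6`, not `6` (faithfulness) — so `2`, and `h` is a product of two transpositions. [cite: Dodson1984, §1.1 Imprimitivity Theorem]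
[cite: Lang2002, I §5 Prop. 5.1] -/
theorem sign_toPermHom_eq_one_of_mem_stabilizer [IsNormalClosure ℚ K L] (h6 : finrank ℚ K = 6) (h12 : finrank ℚ L = 12) (x₀ : K →ₐ[ℚ] L)
    {h : L ≃ₐ[ℚ] L} (hh : h ∈ MulAction.stabilizer (L ≃ₐ[ℚ] L) x₀) : Equiv.Perm.sign (MulAction.toPermHom (L ≃ₐ[ℚ] L) (K →ₐ[ℚ] L) h) = 1 := by
  classical
  by_cases h1 : h = 1
  · rw [h1, map_one, map_one]
  haveI : Normal ℚ L := IsNormalClosure.normal (F := ℚ) (K := K) (L := L)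
  haveI : IsGalois ℚ L := isGalois_of_isNormalClosure (L := L) K
  set H := MulAction.stabilizer (L ≃ₐ[ℚ] L) x₀ with hHdef
  -- `|X| = 6`, `|G| = 12`, `[G:H] = 6`, `|H| = 2`
  have hX : Nat.card (K →ₐ[ℚ] L) = 6 := by rw [Nat.card_eq_fintype_card, card_algHom_eq_finrank (L := L) K, h6]
  have hG : Nat.card (L ≃ₐ[ℚ] L) = 12 := by rw [IsGalois.card_aut_eq_finrank, h12]
  have hHi : H.index = 6 := (MulAction.index_stabilizer_of_transitive (L ≃ₐ[ℚ] L) x₀).trans hX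
  have hHc : Nat.card H = 2 := by have := H.index_mul_card; rw [hHi, hG] at this; omega
  -- `h` has order `2`, and `H = {1, h}`
  have hord : orderOf h = 2 := by
    have hd : orderOf h ∣ 2 := hHc ▸ H.orderOf_dvd_natCard hh
    rcases (Nat.dvd_prime Nat.prime_two).1 hd with h' | h'
    · exact absurd (orderOf_eq_one_iff.1 h') h1
    · exact h'
  have hHmem : ∀ g ∈ H, g = 1 ∨ g = h := by
    have hzp : Subgroup.zpowers h = H := Subgroup.eq_of_le_of_card_ge ((Subgroup.zpowers_le (G := L ≃ₐ[ℚ] L)).2 hh)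
      (by rw [hHc, Nat.card_zpowers, hord])
    intro g hg
    rw [← hzp, mem_zpowers_iff_mem_range_orderOf, hord] at hg
    simp only [Finset.mem_image, Finset.mem_range] at hg
    obtain ⟨i, hi, rfl⟩ := hg
    interval_cases i
    · exact Or.inl (pow_zero h)
    · exact Or.inr (pow_one h)
  -- the permutation `σ` of `h` is an involution
  set σ : Equiv.Perm (K →ₐ[ℚ] L) := MulAction.toPermHom (L ≃ₐ[ℚ] L) (K →ₐ[ℚ] L) h with hσ
  have hσx : ∀ x, σ x = h • x := fun x => rfl
  have hinj : Function.Injective (MulAction.toPermHom (L ≃ₐ[ℚ] L) (K →ₐ[ℚ] L)) := MulAction.toPerm_injective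
  have hordσ : orderOf σ = 2 := by rw [hσ, orderOf_injective _ hinj, hord]
  have hσ2 : σ ^ 2 = 1 := by rw [← hordσ]; exact pow_orderOf_eq_one σ
  -- the fixed points of `σ` form the orbit of `x₀` under the centraliser `C` of `h`
  set C : Subgroup (L ≃ₐ[ℚ] L) := Subgroup.centralizer {h} with hCdef
  have hHC : H ≤ C := fun g hg => by
    rw [hCdef, Subgroup.mem_centralizer_iff]
    rintro _ rfl
    rcases hHmem g hg with rfl | rfl
    · rw [one_mul, mul_one]
    · rfl
  have hfix : MulAction.orbit C x₀ = Function.fixedPoints σ := by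
    ext x
    rw [Function.mem_fixedPoints, Function.IsFixedPt, hσx]
    constructor
    · rintro ⟨g, rfl⟩
      have hg : ∀ h' ∈ ({h} : Set (L ≃ₐ[ℚ] L)), h' * (g : L ≃ₐ[ℚ] L) = (g : L ≃ₐ[ℚ] L) * h' := Subgroup.mem_centralizer_iff.1 g.2
      show h • ((g : L ≃ₐ[ℚ] L) • x₀) = (g : L ≃ₐ[ℚ] L) • x₀
      rw [smul_smul, hg h rfl, mul_smul, MulAction.mem_stabilizer_iff.1 hh]
    · intro hx
      obtain ⟨g, rfl⟩ := MulAction.exists_smul_eq (L ≃ₐ[ℚ] L) x₀ x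
      have hmem : g⁻¹ * h * g ∈ H := by
        rw [hHdef, MulAction.mem_stabilizer_iff, mul_smul, mul_smul, hx, inv_smul_smul]
      rcases hHmem _ hmem with hk | hk
      · refine absurd ?_ h1
        calc h = g * (g⁻¹ * h * g) * g⁻¹ := by group
          _ = 1 := by rw [hk]; group
      · have hgC : g ∈ C := by
          rw [hCdef, Subgroup.mem_centralizer_iff]
          rintro _ rfl
          have := congrArg (g * ·) hk
          simpa [← mul_assoc] using this
        exact ⟨⟨g, hgC⟩, rfl⟩
  -- its size `[C:H]` divides `[G:H] = 6` …
  have hstabC : H.subgroupOf C = MulAction.stabilizer C x₀ := by ext; rfl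
  have hncard : (MulAction.orbit C x₀).ncard = H.relIndex C := by rw [Subgroup.relIndex, hstabC, MulAction.index_stabilizer]
  have hdvd : (MulAction.orbit C x₀).ncard ∣ 6 := by rw [hncard, ← hHi]; exact Subgroup.relIndex_dvd_index_of_le hHC
  -- … and equals `6 − #supp(σ)`, even, not `6`
  have hfixcard : (MulAction.orbit C x₀).ncard = 6 - σ.support.card := by
    rw [hfix, ← Nat.card_coe_set_eq, Nat.card_eq_fintype_card, Equiv.Perm.card_fixedPoints, Equiv.Perm.sum_cycleType, card_algHom_eq_finrank (L := L) K, h6]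
  have h2dvd : 2 ∣ σ.support.card := Equiv.Perm.two_dvd_card_support hσ2
  have hle : σ.support.card ≤ 6 := by
    have := Finset.card_le_univ σ.support; rwa [card_algHom_eq_finrank (L := L) K, h6] at this
  have hne0 : σ.support.card ≠ 0 := fun h0 => by
    apply h1
    apply hinj
    rw [map_one]
    exact Equiv.Perm.support_eq_empty_iff.1 (Finset.card_eq_zero.1 h0)
  have hsupp : σ.support.card = 4 := by
    rw [hfixcard] at hdvd
    obtain ⟨m, hm⟩ := h2dvd
    have hm3 : m ≤ 3 := by omega
    interval_cases m
    · omega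
    · exfalso; rw [hm] at hdvd; norm_num at hdvd
    · omega
    · exfalso; rw [hm] at hdvd; norm_num at hdvd
  rw [sign_eq_of_orderOf_eq_two hordσ, hsupp]
  decide

/-! ## §4 The imaginary quadratic subfield -/

/-- **A SEXTIC CM FIELD WHOSE GALOIS CLOSURE HAS DEGREE `6` OR `12` HAS A TOTALLY COMPLEX QUADRATIC SUBFIELD** (abstract normal closure `L`).  `k = L^{ker χ}` for the sign
character `χ` of `Gal(L/ℚ)` on the six embeddings: quadratic (`χ(c) = −1`), imaginary (`c ∉ ker χ`), inside `x₀(K)` (`χ(Stab x₀) = 1`), pulled back to `K` along `x₀`.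
[cite: Dodson1984, §5.1.2 Theorem] [cite: Lang2002, VI §1 Thm. 1.1 and Cor. 1.4] -/
theorem exists_totallyComplex_quadratic_of_finrank_le_twelve [IsNormalClosure ℚ K L] (h6 : finrank ℚ K = 6) (hL : finrank ℚ L = 6 ∨ finrank ℚ L = 12) :
    ∃ F : IntermediateField ℚ K, finrank ℚ F = 2 ∧ IsTotallyComplex F := by
  classical
  haveI : Normal ℚ L := IsNormalClosure.normal (F := ℚ) (K := K) (L := L)
  haveI : IsGalois ℚ L := isGalois_of_isNormalClosure (L := L) K
  have hcardX : Fintype.card (K →ₐ[ℚ] L) = 6 := (card_algHom_eq_finrank (L := L) K).trans h6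
  obtain ⟨x₀⟩ : Nonempty (K →ₐ[ℚ] L) := Fintype.card_pos_iff.1 (by rw [hcardX]; norm_num)
  have hG : Nat.card (L ≃ₐ[ℚ] L) = finrank ℚ L := IsGalois.card_aut_eq_finrank ℚ L
  -- the sign character and its kernel
  let χ : (L ≃ₐ[ℚ] L) →* ℤˣ := Equiv.Perm.sign.comp (MulAction.toPermHom (L ≃ₐ[ℚ] L) (K →ₐ[ℚ] L))
  have hχc : χ conjGal = -1 := sign_toPermHom_conjGal (L := L) (K := K) (j := 1) (by rw [h6])
  let Q : Subgroup (L ≃ₐ[ℚ] L) := χ.ker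
  have hcQ : (conjGal : L ≃ₐ[ℚ] L) ∉ Q := fun hc => by
    rw [MonoidHom.mem_ker, hχc] at hc
    exact absurd hc (by decide)
  have hχval : ∀ g, χ g = 1 ∨ χ g = -1 := fun g => Int.units_eq_one_or (χ g)
  have hQi : Q.index = 2 := by
    refine Subgroup.index_eq_two_iff.2 ⟨conjGal, fun b => ?_⟩
    simp only [Q, MonoidHom.mem_ker, map_mul, hχc]
    rcases hχval b with hb | hb <;> rw [hb] <;> decide
  -- the stabiliser of `x₀` lies in the kernel
  have hHQ : MulAction.stabilizer (L ≃ₐ[ℚ] L) x₀ ≤ Q := by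
    intro h hh
    rw [MonoidHom.mem_ker]
    rcases hL with hL6 | hL12
    · -- `[L:ℚ] = 6`: the stabiliser is trivial
      have hHi : (MulAction.stabilizer (L ≃ₐ[ℚ] L) x₀).index = 6 :=
        (MulAction.index_stabilizer_of_transitive (L ≃ₐ[ℚ] L) x₀).trans (by rw [Nat.card_eq_fintype_card, hcardX])
      have hHc : Nat.card (MulAction.stabilizer (L ≃ₐ[ℚ] L) x₀) = 1 := by
        have := (MulAction.stabilizer (L ≃ₐ[ℚ] L) x₀).index_mul_card; rw [hHi, hG, hL6] at this; omega
      rw [(MulAction.stabilizer (L ≃ₐ[ℚ] L) x₀).eq_bot_of_card_eq hHc, Subgroup.mem_bot] at hh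
      rw [hh, map_one]
    · exact sign_toPermHom_eq_one_of_mem_stabilizer h6 hL12 x₀ hh
  -- the fixed field `k = L^Q`: quadratic, inside `x₀(K)`, moved by `c`
  let k : IntermediateField ℚ L := fixedField Q
  have hk2 : finrank ℚ k = 2 := by
    have h1 : finrank k L = Nat.card Q := finrank_fixedField_eq_card Q
    have h2 : finrank ℚ k * finrank k L = finrank ℚ L := Module.finrank_mul_finrank ℚ k L
    have h3 : Q.index * Nat.card Q = Nat.card (L ≃ₐ[ℚ] L) := Q.index_mul_card
    rw [hQi, hG] at h3
    rw [h1, ← h3] at h2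
    have hQpos : 0 < Nat.card Q := Nat.card_pos
    exact Nat.eq_of_mul_eq_mul_right hQpos h2
  have hkK : k ≤ x₀.fieldRange := by
    rw [← fixedField_stabilizer_algHom]
    exact fixedField_le hHQ
  have hkc : ∃ z ∈ k, IsCMField.complexConj L z ≠ z := by
    by_contra hno
    push Not at hno
    apply hcQ
    have hmem : (conjGal : L ≃ₐ[ℚ] L) ∈ k.fixingSubgroup := by
      rw [IntermediateField.mem_fixingSubgroup_iff]
      intro z hz
      exact hno z hz
    rwa [IntermediateField.fixingSubgroup_fixedField] at hmem
  -- `k` is totally complex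
  haveI hktc : IsTotallyComplex k := by
    obtain ⟨z, hz, hcz⟩ := hkc
    obtain ⟨ψ⟩ : Nonempty (L →+* ℂ) := inferInstance
    let φ : k →+* ℂ := ψ.comp (algebraMap k L)
    have hφ : ¬ ComplexEmbedding.IsReal φ := fun hr => by
      have h1 := RingHom.congr_fun (ComplexEmbedding.isReal_iff.1 hr) ⟨z, hz⟩
      rw [ComplexEmbedding.conjugate_coe_eq] at h1
      change starRingEnd ℂ (ψ z) = ψ z at h1
      rw [← IsCMField.complexEmbedding_complexConj L ψ z] at h1
      exact hcz (ψ.injective h1)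
    have hcx : (InfinitePlace.mk φ).IsComplex := not_isReal_iff_isComplex.1 fun hr => hφ (isReal_mk_iff.1 hr)
    have hpos : 0 < nrComplexPlaces k := Fintype.card_pos_iff.2 ⟨⟨InfinitePlace.mk φ, hcx⟩⟩
    have hsum := card_add_two_mul_card_eq_rank k
    rw [hk2] at hsum
    exact (NumberField.nrRealPlaces_eq_zero_iff (K := k)).1 (by omega)
  -- pull `k ≤ x₀(K)` back to `K`
  let F : IntermediateField ℚ K := k.comap x₀
  have hFmem : ∀ y : K, y ∈ F ↔ x₀ y ∈ k := fun y => Iff.rfl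
  let f : F →ₐ[ℚ] k := (x₀.comp F.val).codRestrict k.toSubalgebra fun y => (hFmem y.1).1 y.2
  have hf : Function.Bijective f := by
    refine ⟨fun a b hab => ?_, fun z => ?_⟩
    · have h1 : x₀ a.1 = x₀ b.1 := congrArg Subtype.val hab
      exact Subtype.ext (x₀.injective h1)
    · obtain ⟨y, hy⟩ := hkK z.2
      exact ⟨⟨y, (hFmem y).2 (hy ▸ z.2)⟩, Subtype.ext hy⟩
  let e : F ≃ₐ[ℚ] k := AlgEquiv.ofBijective f hf
  refine ⟨F, (e.toLinearEquiv.finrank_eq).trans hk2, ?_⟩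
  letI : Algebra k F := e.symm.toRingEquiv.toRingHom.toAlgebra
  exact isTotallyComplex_of_algebra k F

end Galois

/-! ## §5 The closure in `ℂ`: the equivalences -/

section Complex

variable {I : Type} {K : I → Type} [∀ i, Field (K i)] [∀ i, NumberField (K i)] [∀ i, IsCMField (K i)]

/-- **A SEXTIC CM FIELD WHOSE GALOIS CLOSURE IN `ℂ` HAS DEGREE `6` OR `12` HAS A TOTALLY COMPLEX QUADRATIC SUBFIELD.** [cite: Dodson1984, §5.1.2 Theorem]
[cite: Lang2002, VI §1 Thm. 1.1 and Cor. 1.4] -/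
theorem exists_totallyComplex_quadratic_of_finrank_normalClosure {i : I} (h6 : finrank ℚ (K i) = 6)
    (hL : finrank ℚ ↥(normalClosure ℚ (K i) ℂ) = 6 ∨ finrank ℚ ↥(normalClosure ℚ (K i) ℂ) = 12) :
    ∃ F : IntermediateField ℚ (K i), finrank ℚ F = 2 ∧ IsTotallyComplex F := by
  haveI : NumberField ↥(normalClosure ℚ (K i) ℂ) := NumberField.mk
  haveI : IsNormalClosure ℚ (K i) ↥(normalClosure ℚ (K i) ℂ) := Algebra.IsAlgebraic.isNormalClosure_normalClosure fun x => IsAlgClosed.splits _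
  haveI : IsCMField ↥(normalClosure ℚ (K i) ℂ) := isCMField_of_isNormalClosure (K := K i) (L := ↥(normalClosure ℚ (K i) ℂ))
  exact exists_totallyComplex_quadratic_of_finrank_le_twelve (L := ↥(normalClosure ℚ (K i) ℂ)) h6 hL

/-- **THE DICHOTOMY.**  For a sextic CM field: a totally complex quadratic subfield EXISTS iff the Galois closure in `ℂ` has degree `6` or `12` (seat b16's
`finrank_normalClosure_of_quadratic` and its converse). [cite: Dodson1984, §5.1.2 Theorem] -/
theorem exists_totallyComplex_quadratic_iff_finrank_normalClosure {i : I} (h6 : finrank ℚ (K i) = 6) :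
    (∃ F : IntermediateField ℚ (K i), finrank ℚ F = 2 ∧ IsTotallyComplex F) ↔
      (finrank ℚ ↥(normalClosure ℚ (K i) ℂ) = 6 ∨ finrank ℚ ↥(normalClosure ℚ (K i) ℂ) = 12) := by
  refine ⟨fun ⟨F, hF2, hFtc⟩ => ?_, exists_totallyComplex_quadratic_of_finrank_normalClosure h6⟩
  haveI := hFtc
  exact finrank_normalClosure_of_quadratic (K := K) h6 hF2 (algebraMap F (K i))

/-- **… equivalently, NO totally complex quadratic subfield iff the closure has degree `24` or `48`** (the degree divides `48` and is a multiple of `6`: seat b16's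
`finrank_dvd_48_of_sextic_cm`, `finrank_dvd_finrank_normalClosure`). [cite: Dodson1984, §5.1.2 Theorem] -/
theorem not_exists_totallyComplex_quadratic_iff_finrank_normalClosure {i : I} (h6 : finrank ℚ (K i) = 6) :
    (¬ ∃ F : IntermediateField ℚ (K i), finrank ℚ F = 2 ∧ IsTotallyComplex F) ↔
      (finrank ℚ ↥(normalClosure ℚ (K i) ℂ) = 24 ∨ finrank ℚ ↥(normalClosure ℚ (K i) ℂ) = 48) := by
  rw [exists_totallyComplex_quadratic_iff_finrank_normalClosure h6]
  haveI : NumberField ↥(normalClosure ℚ (K i) ℂ) := NumberField.mk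
  haveI : IsNormalClosure ℚ (K i) ↥(normalClosure ℚ (K i) ℂ) := Algebra.IsAlgebraic.isNormalClosure_normalClosure fun x => IsAlgClosed.splits _
  haveI : IsCMField ↥(normalClosure ℚ (K i) ℂ) := isCMField_of_isNormalClosure (K := K i) (L := ↥(normalClosure ℚ (K i) ℂ))
  have h48 : finrank ℚ ↥(normalClosure ℚ (K i) ℂ) ∣ 48 := finrank_dvd_48_of_sextic_cm (L := ↥(normalClosure ℚ (K i) ℂ)) (K i) h6
  have h6dvd : 6 ∣ finrank ℚ ↥(normalClosure ℚ (K i) ℂ) := h6 ▸ finrank_dvd_finrank_normalClosure (K := K) i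
  have hpos : 0 < finrank ℚ ↥(normalClosure ℚ (K i) ℂ) := Module.finrank_pos
  have hle : finrank ℚ ↥(normalClosure ℚ (K i) ℂ) ≤ 48 := Nat.le_of_dvd (by norm_num) h48
  obtain ⟨m, hm⟩ := h6dvd
  constructor
  · intro h
    interval_cases hd : finrank ℚ ↥(normalClosure ℚ (K i) ℂ) <;> omega
  · rintro (h | h) <;> rw [h] <;> decide


/-! ## §6 Pair flips ⟺ no imaginary quadratic subfield -/

/-- **PAIR FLIPS ⟺ NO IMAGINARY QUADRATIC SUBFIELD** for a sextic CM field: seat p2's `GenericCMField.pairFlip_of_finrank_normalClosure` (closure of degree `24`/`48` ⟹ pair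
flips), seat b16's `not_forall_pairFlip_of_quadratic` (imaginary quadratic subfield ⟹ no pair flip) and §5.  So the three dichotomies «imaginary quadratic subfield», «closure of
degree `≤ 12`», «no pair flip» of sextic CM fields are ONE. [cite: Dodson1984, §5.1.2 Theorem] -/
theorem pairFlip_iff_not_exists_totallyComplex_quadratic {i : I} (h6 : finrank ℚ (K i) = 6) :
    (∀ s : K i →+* ℂ, ∃ σ : ℂ ≃+* ℂ, σ • s = (starRingAut : ℂ ≃+* ℂ) • s ∧ ∀ t : K i →+* ℂ, t ≠ s → t ≠ (starRingAut : ℂ ≃+* ℂ) • s → σ • t = t) ↔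
      ¬ ∃ F : IntermediateField ℚ (K i), finrank ℚ F = 2 ∧ IsTotallyComplex F := by
  refine ⟨fun hflip ⟨F, hF2, hFtc⟩ => ?_, fun hno => ?_⟩
  · haveI := hFtc
    exact not_forall_pairFlip_of_quadratic (K := K) h6 hF2 (algebraMap F (K i)) hflip
  · haveI : NumberField ↥(normalClosure ℚ (K i) ℂ) := NumberField.mk
    haveI : IsNormalClosure ℚ (K i) ↥(normalClosure ℚ (K i) ℂ) := Algebra.IsAlgebraic.isNormalClosure_normalClosure fun x => IsAlgClosed.splits _
    exact GenericCMField.pairFlip_of_finrank_normalClosure h6 _ ((not_exists_totallyComplex_quadratic_iff_finrank_normalClosure h6).1 hno)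

end Complex

end Summit.HodgeConjecture.CorCM.MultiFieldWeil

end
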